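import Summits.PneNP.PneNP.Theorems.ConvexRankGatesConvexGateBlindExactLiftingTriangleLineRepUnique
import Summits.PneNP.PneNP.Theorems.ConvexRankGatesConvexGateBlindExactLiftingTriangleIsolationND

/-!
# Triangle instance — the CORRECTED bridge: generator rigidity of the cheap corner ⇒ an ε-uniform strict-rank jump

Support file for crux `ConvexGateBlind` (stmt-PneNP-10680), open stub `stub_exactLifting`; prover seat 0, session 35,
memo ANALYSIS14 §4 (correcting session 28's `…TriangleJump`, whose termwise hypothesis R1 is unsatisfiable —
`…TriangleJumpVacuous`). `M_t[x,w] = monoCount x w ∈ {1,3}`, `f_t(ε) = rk₊(M_t − εJ)`, cheap corner `rk₊(M_t) ≤ 3t²`.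

**The corrected hypothesis R1′ (GENERATOR rigidity of the cheap corner).** Every non-negative factorisation of the
unshifted `M_t` with terms indexed by the lines has, up to a permutation `σ` of the index set, LINE INDICATORS AS COLUMN
FUNCTIONS: every term is `c_L(x) · [w ∈ σL]` for some non-negative usage `c` — about which NOTHING is assumed (on
nondegenerate rows it is then forced to be the line pattern, `…TriangleLineRepUnique`; on degenerate rows it is
genuinely free, `…TriangleJumpVacuous`). R1′ is open for `t ≥ 4` and false for `t ≤ 3` (points).

**Theorem (`jump_of_lineGenRigid`, `…_fin`, registered `triangle_jump_of_generator_rigidity`).** R1′ ∧ `t ≥ 3` ⇒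
`∃ ε₀ > 0 ∀ ε ∈ (0, ε₀)`: `M_t − εJ` has no non-negative factorisation with `≤ 3t²` terms (`f_t(ε) ≥ 3t² + 1` near `0⁺`).

Proof: compactness (`XorDoor.exists_limit_nmf`) gives a limit factorisation of `M_t` with termwise convergence; by R1′ its
terms are `c_L ⊗ 1_{σL}`; by uniqueness on nondegenerate rows `c_{σ⁻¹L}(x) = [L mono_x]` whenever `mu x ≠ 0`; every line
is monochromatic under SOME nondegenerate row (`goodRow`), so the line masses are eventually positive and, after rescaling
the columns to mean `1` on their lines, the rows are `10⁻⁵`-close to the line pattern ON NONDEGENERATE ROWS — which is all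
that THEOREM B_ND (`ND.isolation`, closeness only where `mu x ≠ 0`) asks; it forces `ε_n ≤ 0`, a contradiction.
-/

set_option linter.dupNamespace false -- `Summit.PneNP.PneNP.…`: summit = sub-problem (D-0017)

namespace Summit.PneNP.PneNP.Theorems.XorDoor.TriLine

open Filter Topology Finset

noncomputable section

variable {t : ℕ}

/-! ## A nondegenerate row under which a given line is monochromatic -/

/-- colour one vertex `false` and the rest of the block `true` -/
def oneFalse (p : Fin t) : Fin t → Bool := fun v => decide (v ≠ p)

/-- such a block is two-coloured when `t ≥ 2` -/
lemma cp_oneFalse_ne_zero (ht : 2 ≤ t) (p : Fin t) : cp (oneFalse p) ≠ 0 := by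
  rw [cp_ne_zero_iff]
  obtain ⟨q, hq⟩ := Fintype.exists_ne_of_one_lt_card (by simp; omega) p
  exact ⟨p, q, by simp [oneFalse, hq]⟩

/-- a nondegenerate row under which the line `L` is monochromatic (its two fixed vertices are `false`) -/
def goodRow (p₀ : Fin t) : Line t → Col t
  | Sum.inl (a, b) => (oneFalse a, oneFalse b, oneFalse p₀)
  | Sum.inr (Sum.inl (a, d)) => (oneFalse a, oneFalse p₀, oneFalse d)
  | Sum.inr (Sum.inr (b, d)) => (oneFalse p₀, oneFalse b, oneFalse d)

/-- the good row is nondegenerate -/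
lemma mu_goodRow_ne_zero (ht : 2 ≤ t) (p₀ : Fin t) (L : Line t) : mu (goodRow p₀ L) ≠ 0 := by
  rw [mu_ne_zero_iff]
  rcases L with ⟨a, b⟩ | ⟨a, d⟩ | ⟨b, d⟩ <;>
    exact ⟨cp_oneFalse_ne_zero ht _, cp_oneFalse_ne_zero ht _, cp_oneFalse_ne_zero ht _⟩

/-- the line is monochromatic under its good row -/
lemma mInd_goodRow (p₀ : Fin t) (L : Line t) : mInd (goodRow p₀ L) L = 1 := by
  unfold mInd
  rw [if_pos]
  rcases L with ⟨a, b⟩ | ⟨a, d⟩ | ⟨b, d⟩ <;> simp [goodRow, oneFalse]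

/-! ## The corrected bridge -/

/-- **Generator rigidity ⇒ ε-uniform jump** (terms indexed by `Line t`). Hypothesis `hR` = R1′: every line-indexed
non-negative factorisation of `M_t` has, up to a permutation of the indices, line indicators as column functions (each
term is `c_L(x)·[w ∈ σL]`, `c ≥ 0` arbitrary). Conclusion (`t ≥ 3`): for all small `ε > 0`, `M_t − εJ` has no
non-negative factorisation indexed by the lines. -/
theorem jump_of_lineGenRigid (ht : 3 ≤ t)
    (hR : ∀ (u : Line t → Col t → ℝ) (v : Line t → Tri t → ℝ), IsNMF t 0 u v →
      ∃ (σ : Equiv.Perm (Line t)) (c : Line t → Col t → ℝ), (∀ L x, 0 ≤ c L x) ∧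
        ∀ L x w, u L x * v L w = c L x * lind (σ L) w) :
    ∃ ε₀ : ℝ, 0 < ε₀ ∧ ∀ ε : ℝ, 0 < ε → ε < ε₀ →
      ∀ (u : Line t → Col t → ℝ) (v : Line t → Tri t → ℝ), ¬ IsNMF t ε u v := by
  classical
  by_contra hcon
  push Not at hcon
  -- a sequence of strict factorisations with shifts `ε n ∈ (0, 1/(n+1))`
  have hseq : ∀ n : ℕ, ∃ ε : ℝ, 0 < ε ∧ ε < 1 / ((n : ℝ) + 1) ∧
      ∃ (u : Line t → Col t → ℝ) (v : Line t → Tri t → ℝ), IsNMF t ε u v := by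
    intro n
    obtain ⟨ε, hε0, hε1, u, v, h⟩ := hcon (1 / ((n : ℝ) + 1)) (by positivity)
    exact ⟨ε, hε0, hε1, u, v, h⟩
  choose ε hε0 hε1 u v hNMF using hseq
  have hεlim : Tendsto ε atTop (𝓝 0) := by
    refine squeeze_zero (fun n => (hε0 n).le) (fun n => (hε1 n).le) ?_
    exact tendsto_one_div_add_atTop_nhds_zero_nat
  -- compactness: a limit factorisation of `M_t` with termwise convergence along a subsequence
  obtain ⟨u₀, v₀, hu₀, hv₀, hf₀, φ, hφ, hterm⟩ :=
    XorDoor.exists_limit_nmf (fun (x : Col t) (w : Tri t) => (monoCount x w : ℝ)) ε hεlim u v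
      (fun n => (hNMF n).u_nonneg) (fun n => (hNMF n).v_nonneg) (fun n => (hNMF n).fact)
  have h0 : IsNMF t 0 u₀ v₀ := ⟨hu₀, hv₀, fun x w => by rw [hf₀ x w, sub_zero]⟩
  -- generator rigidity: the limit has line indicators as column functions, up to the permutation `σ`
  obtain ⟨σ, c, hc, hσ⟩ := hR u₀ v₀ h0
  set τ := σ.symm with hτ
  have hστ : ∀ L, σ (τ L) = L := fun L => σ.apply_symm_apply L
  -- uniqueness on nondegenerate rows: there the limit usage is the line pattern
  have hcrep : ∀ x w, ∑ L, c L x * lind (σ L) w = (monoCount x w : ℝ) := by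
    intro x w; rw [← hf₀ x w]; exact sum_congr rfl fun L _ => (hσ L x w).symm
  have hcm : ∀ x, mu x ≠ 0 → ∀ L, c (τ L) x = mInd x L := by
    intro x hx L
    have := usage_eq_mInd_of_lines hc σ hcrep hx (τ L)
    rwa [hστ] at this
  -- relabelled terms converge to `c_{τL}(x) · 1_L(w)`
  have hterm' : ∀ L x w, Tendsto (fun n => u (φ n) (τ L) x * v (φ n) (τ L) w) atTop
      (𝓝 (c (τ L) x * lind L w)) := by
    intro L x w
    have := hterm (τ L) x w
    rwa [hσ (τ L) x w, hστ] at this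
  -- line masses and the products `P n L x = u·mass → t·c_{τL}(x)`
  set mass : ℕ → Line t → ℝ := fun n L => ∑ w, lind L w * v (φ n) (τ L) w with hmass
  have hmass0 : ∀ n L, 0 ≤ mass n L :=
    fun n L => sum_nonneg fun w _ => mul_nonneg (lind_nonneg L w) ((hNMF (φ n)).v_nonneg _ _)
  have hP : ∀ L x, Tendsto (fun n => u (φ n) (τ L) x * mass n L) atTop (𝓝 (c (τ L) x * t)) := by
    intro L x
    have h1 : ∀ n, u (φ n) (τ L) x * mass n L = ∑ w, lind L w * (u (φ n) (τ L) x * v (φ n) (τ L) w) := by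
      intro n; simp only [hmass, mul_sum]; exact sum_congr rfl fun w _ => by ring
    have h2 : c (τ L) x * t = ∑ w, lind L w * (c (τ L) x * lind L w) := by
      have : ∑ w, lind L w * (c (τ L) x * lind L w) = c (τ L) x * ∑ w, lind L w * lind L w := by
        rw [mul_sum]; exact sum_congr rfl fun w _ => by ring
      rw [this]
      simp only [lind_mul_self, sum_lind L]
    simp only [h1]
    rw [h2]
    exact tendsto_finsetSum _ fun w _ => (hterm' L x w).const_mul _
  -- eventually: every line mass is positive and every rescaled NONDEGENERATE row is `10⁻⁵`-close to the pattern
  have ht0 : (0 : ℝ) < t := by exact_mod_cast (show 0 < t by omega)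
  have ht2 : 2 ≤ t := by omega
  obtain ⟨p₀⟩ : Nonempty (Fin t) := ⟨⟨0, by omega⟩⟩
  have hev1 : ∀ L, ∀ᶠ n in atTop, (t : ℝ) / 2 < u (φ n) (τ L) (goodRow p₀ L) * mass n L := by
    intro L
    have h := hP L (goodRow p₀ L)
    rw [hcm _ (mu_goodRow_ne_zero ht2 p₀ L), mInd_goodRow, one_mul] at h
    exact h.eventually_const_lt (by linarith)
  have hev2 : ∀ L x, ∀ᶠ n in atTop, mu x ≠ 0 → |u (φ n) (τ L) x * mass n L / t - mInd x L| < 1 / 100000 := by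
    intro L x
    by_cases hx : mu x = 0
    · exact Eventually.of_forall fun n h => (h hx).elim
    · have h := (hP L x).div_const (t : ℝ)
      rw [mul_div_assoc, div_self ht0.ne', mul_one, hcm x hx] at h
      have := Metric.tendsto_nhds.1 h (1 / 100000) (by norm_num)
      simp only [Real.dist_eq] at this
      exact this.mono fun n hn _ => hn
  have hev : ∀ᶠ n in atTop, (∀ L, (t : ℝ) / 2 < u (φ n) (τ L) (goodRow p₀ L) * mass n L) ∧
      ∀ L x, mu x ≠ 0 → |u (φ n) (τ L) x * mass n L / t - mInd x L| < 1 / 100000 := by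
    refine (eventually_all.2 hev1).and (eventually_all.2 fun L => eventually_all.2 (hev2 L))
  obtain ⟨n, hn1, hn2⟩ := hev.exists
  -- the rescaled, relabelled factorisation at stage `n`
  have hmpos : ∀ L, 0 < mass n L := by
    intro L
    by_contra hle
    have hm0 : mass n L = 0 := le_antisymm (not_lt.1 hle) (hmass0 n L)
    have := hn1 L
    rw [hm0, mul_zero] at this
    linarith
  set U : Line t → Col t → ℝ := fun L x => u (φ n) (τ L) x * (mass n L / t) with hU
  set V : Line t → Tri t → ℝ := fun L w => v (φ n) (τ L) w * (t / mass n L) with hV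
  have hUV : ∀ L x w, U L x * V L w = u (φ n) (τ L) x * v (φ n) (τ L) w := by
    intro L x w
    simp only [hU, hV]
    field_simp [(hmpos L).ne', ht0.ne']
  have hLF : ND.IsLineFactND t (ε (φ n)) (1 / 100000) U V := by
    refine ⟨?_, ?_, ?_, ?_, by norm_num, ?_⟩
    · intro L x
      exact mul_nonneg ((hNMF (φ n)).u_nonneg _ _) (div_nonneg (hmass0 n L) ht0.le)
    · intro L w
      exact mul_nonneg ((hNMF (φ n)).v_nonneg _ _) (div_nonneg ht0.le (hmass0 n L))
    · intro x w
      simp only [hUV]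
      rw [← (hNMF (φ n)).fact x w]
      exact Equiv.sum_comp τ (fun i => u (φ n) i x * v (φ n) i w)
    · intro L
      simp only [hV]
      calc ∑ w, lind L w * (v (φ n) (τ L) w * (t / mass n L))
          = (∑ w, lind L w * v (φ n) (τ L) w) * (t / mass n L) := by
              rw [sum_mul]; exact sum_congr rfl fun w _ => by ring
        _ = t := by
              change mass n L * (t / mass n L) = t
              field_simp [(hmpos L).ne']
    · intro L x hx
      simp only [hU]
      have := hn2 L x hx
      rw [mul_div_assoc] at this
      exact this.le
  have := ND.isolation ht hLF le_rfl
  linarith [hε0 (φ n)]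

/-- **Generator rigidity ⇒ ε-uniform jump**, counted form: under R1′ and `t ≥ 3` there is `ε₀ > 0` such that for
`0 < ε < ε₀` no non-negative factorisation of `M_t − εJ` has `R ≤ 3t²` terms (`f_t(ε) ≥ 3t² + 1` near `0⁺`). -/
theorem jump_of_lineGenRigid_fin (ht : 3 ≤ t)
    (hR : ∀ (u : Line t → Col t → ℝ) (v : Line t → Tri t → ℝ), IsNMF t 0 u v →
      ∃ (σ : Equiv.Perm (Line t)) (c : Line t → Col t → ℝ), (∀ L x, 0 ≤ c L x) ∧
        ∀ L x w, u L x * v L w = c L x * lind (σ L) w) :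
    ∃ ε₀ : ℝ, 0 < ε₀ ∧ ∀ ε : ℝ, 0 < ε → ε < ε₀ → ∀ R : ℕ, R ≤ 3 * t ^ 2 →
      ∀ (u : Fin R → Col t → ℝ) (v : Fin R → Tri t → ℝ), ¬ IsNMF t ε u v := by
  obtain ⟨ε₀, hε₀, h⟩ := jump_of_lineGenRigid ht hR
  refine ⟨ε₀, hε₀, fun ε hε hε' R hRle u v hN => ?_⟩
  obtain ⟨U, V, hUV⟩ := isNMF_line_of_fin hRle hN
  exact h ε hε hε' U V hUV

/-- **The line factorisation satisfies R1′'s conclusion** (sanity: the hypothesis is not vacuous at the reference point —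
the second factorisation of `…TriangleJumpVacuous` is also of this form, with `σ = 1` and a non-pattern usage `c`). -/
lemma lineGenRigid_of_lines (u : Line t → Col t → ℝ) (hu : ∀ L x, 0 ≤ u L x) :
    ∃ (σ : Equiv.Perm (Line t)) (c : Line t → Col t → ℝ), (∀ L x, 0 ≤ c L x) ∧
      ∀ L x w, u L x * lind L w = c L x * lind (σ L) w :=
  ⟨1, u, hu, fun _ _ _ => rfl⟩

/-! ## The registered form (self-contained signature) -/

/-- **Generator rigidity of the cheap corner ⇒ ε-uniform strict-rank jump on the triangle instance** (registered
sub-goal `triangle_jump_of_generator_rigidity` of stmt-PneNP-10680, verbatim signature; it REPLACES the vacuous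
`triangle_jump_of_rigidity`). Rows `x ∈ (Fin t → Bool)³`, columns `w ∈ (Fin t)³`, `M_t[x,w]` = the three `if`s; lines
indexed by `(Fin t × Fin t) ⊕ (Fin t × Fin t) ⊕ (Fin t × Fin t)`. HYPOTHESIS (R1′): every line-indexed non-negative
factorisation of `M_t` has, after a permutation `σ` of the indices, every term of the form `c L x · [w ∈ σ L]` with
`c ≥ 0`. CONCLUSION: for some `ε₀ > 0` and all `ε ∈ (0, ε₀)`, `M_t − εJ` has no non-negative factorisation with
`R ≤ 3t²` terms (`t ≥ 3`). -/
theorem triangle_jump_of_generator_rigidity : ∀ (t : ℕ), 3 ≤ t → (∀ (u : (Fin t × Fin t) ⊕ (Fin t × Fin t) ⊕ (Fin t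
    × Fin t) → (Fin t → Bool) × (Fin t → Bool) × (Fin t → Bool) → ℝ) (v : (Fin t × Fin t) ⊕ (Fin t × Fin t) ⊕ (Fin t
    × Fin t) → Fin t × Fin t × Fin t → ℝ), (∀ L x, 0 ≤ u L x) → (∀ L w, 0 ≤ v L w) → (∀ x w, ∑ L, u L x * v L w =
    ((if x.1 w.1 = x.2.1 w.2.1 then 1 else 0) + (if x.1 w.1 = x.2.2 w.2.2 then 1 else 0) + (if x.2.1 w.2.1 = x.2.2
    w.2.2 then 1 else 0) : ℝ)) → ∃ (σ : Equiv.Perm ((Fin t × Fin t) ⊕ (Fin t × Fin t) ⊕ (Fin t × Fin t))) (c : (Fin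
    t × Fin t) ⊕ (Fin t × Fin t) ⊕ (Fin t × Fin t) → (Fin t → Bool) × (Fin t → Bool) × (Fin t → Bool) → ℝ), (∀ L x, 0
    ≤ c L x) ∧ ∀ L x w, u L x * v L w = c L x * Sum.elim (fun ab : Fin t × Fin t => if w.1 = ab.1 ∧ w.2.1 = ab.2
    then (1 : ℝ) else 0) (Sum.elim (fun ad : Fin t × Fin t => if w.1 = ad.1 ∧ w.2.2 = ad.2 then (1 : ℝ) else 0) (fun
    bd : Fin t × Fin t => if w.2.1 = bd.1 ∧ w.2.2 = bd.2 then (1 : ℝ) else 0)) (σ L)) → ∃ ε₀ : ℝ, 0 < ε₀ ∧ ∀ ε : ℝ,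
    0 < ε → ε < ε₀ → ∀ R : ℕ, R ≤ 3 * t ^ 2 → ∀ (u : Fin R → (Fin t → Bool) × (Fin t → Bool) × (Fin t → Bool) → ℝ)
    (v : Fin R → Fin t × Fin t × Fin t → ℝ), (∀ i x, 0 ≤ u i x) → (∀ i w, 0 ≤ v i w) → ¬ (∀ x w, ∑ i, u i x * v i w
    = ((if x.1 w.1 = x.2.1 w.2.1 then 1 else 0) + (if x.1 w.1 = x.2.2 w.2.2 then 1 else 0) + (if x.2.1 w.2.1 = x.2.2
    w.2.2 then 1 else 0) : ℝ) - ε) := by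
  intro t ht hR
  have hR' : ∀ (u : Line t → Col t → ℝ) (v : Line t → Tri t → ℝ), IsNMF t 0 u v →
      ∃ (σ : Equiv.Perm (Line t)) (c : Line t → Col t → ℝ), (∀ L x, 0 ≤ c L x) ∧
        ∀ L x w, u L x * v L w = c L x * lind (σ L) w := by
    intro u v h
    obtain ⟨σ, c, hc, hσ⟩ := hR u v h.u_nonneg h.v_nonneg fun x w => by
      rw [h.fact x w, sub_zero]; simp only [monoCount]; push_cast; ring
    refine ⟨σ, c, hc, fun L x w => ?_⟩
    rw [hσ L x w, lind_eq_elim]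
  obtain ⟨ε₀, hε₀, h⟩ := jump_of_lineGenRigid_fin ht hR'
  refine ⟨ε₀, hε₀, fun ε hε hε' R hRle u v hu hv hf => h ε hε hε' R hRle u v ⟨hu, hv, fun x w => ?_⟩⟩
  rw [hf x w]; simp only [monoCount]; push_cast; ring

end

end Summit.PneNP.PneNP.Theorems.XorDoor.TriLine
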